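import Summits.QuantumFields.BalabanUV.Beta.FP.PeriodisedFormIndexWardDoubled
import Literature.MathematicalPhysics.QuantumFieldTheory.Balaban1983to89.Beta.WilsonVertex2Sym

/-!
# `BalabanUV.Beta.FP.PeriodisedFormOrderTwoParity` — road «FP» for binder row D1, ROUTE T, option (δ) «LIFT ∕ GRADED» (R-FP-54′): **THE
# PERIODISED SECOND-ORDER WILSON FORM FAMILY IS A SYMMETRIC MATRIX** — the order-2 companion of `PeriodisedFormIndexWardDoubled.torus_H1_transpose`
# (order 1: ANTISYMMETRIC) — for every leg-symmetric position table `T` (`swapIJ T = T`: `symTab T′`, `wsym22 N`, their scalar multiples)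

WHAT.  The graded door `FP/NestedStepLawOneShotJetsGraded.secondVar_oneShot_nestedStepLaw_jets_graded` (OWNER d1-p3 g18, (9b)) displays the
parities of the composite form jets; `FP/GradedFormParity` (leaf-05 g28) reduces them to the parities of the TABLES: `H₀ᵀ = H₀`, `H₁ᵀ = −H₁`,
`H₂ᵀ = H₂` and the `G`-table parities.  At level 0 the Wilson member of the order-1 slot is `torus_H1_transpose` (p322868).  This file types the
Wilson member of the ORDER-2 slot: for the bi-stencil family `WilsonBiStencil.wilsonW₂ d T` of a position table with `swapIJ T = T`
(fluctuation-leg symmetric — `WilsonVertex2Sym.wilsonW₂_transpose`), the lattice-periodised kernel is a symmetric matrix, member by member and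
summed against ANY bi-weight `w b b′`:
* `trF_dper_wilsonW₂`, `perF_dper_wilsonW₂_transpose` — kernel level;
* `torus_H2_family_transpose` — `(H₂^{b b′})ᵀ = H₂^{b b′}`, `H₂^{b b′} := perF M (dper M (wilsonW₂ d T b.2 b.1 b′.2 b′.1))∘(fields, fields)`;
* `torus_H2_transpose` — `(Σ_{b b′} w b b′ • H₂^{b b′})ᵀ = Σ_{b b′} w b b′ • H₂^{b b′}`;
* instances `swapIJ_wsym22`, `swapIJ_smul_of_swapIJ`, `torus_H2_transpose_symTab`, `torus_H2_transpose_wsym22` (`T := r • wsym22 N`, e.g. the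
  wall's `(8N²)⁻¹ • wsym22 N`).
Nothing of the dictionary is asserted: WHICH bi-weight and WHICH normalisation of `T` the torus call's `H₂` slot takes at level 0 is the OWNER's ∕
an2's word; the lemma holds for all of them.

HONEST DEPENDENCY (page 1, mandatory): continuum YM on T⁴ ⇐ BetaPertH ∧ nine spine estimates (0/9 proved); BetaPertH ⇐ (D1) ∧ (D4) ∧ CAP+tail;
G-an2-4 gates asym, D1 and NE2/3/4.  HONEST FRAMING (cell contract, verbatim): «discharging `BetaPertH` makes Bałaban's UV stability UNCONDITIONAL —
a real constructive-QFT result; it is NOT the continuum limit and NOT the Clay problem.»  ABSOLUTE RULE (cell charter, verbatim): «No internally-minted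
statement may enter as a cited fact. Every hypothesis is either kernel-proved in this package or a verbatim quotation of a PUBLISHED theorem with page
reference. The manuscript(s) under audit are NOT citable for their own disputed steps — they are the thing under adjudication; programme-internal
(2001/route/tribunal) claims are never citable.»  [folklore] re-indexing algebra over OUR typed objects BY NAME; no `def`, no `def … : Prop`, nothing
cited, 0 sorry; 0 estimates; 0∕4 row-D1 binders; NOT (T-ID), NOT SDF, NOT D1, NOT BetaPertH, NOT continuum, NOT Clay.  D1 formalisation swarm LEAF
PROVER 05 (b2b-balaban-beta-d1-formalise-leaf-05 gen 28), 2026-08-22.  No existing file touched.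
-/

noncomputable section

open scoped BigOperators

namespace Summit.QuantumFields.BalabanUV.Beta.FP.PeriodisedFormOrderTwoParity

open Finset Matrix
open Literature.MathematicalPhysics.QuantumFieldTheory.Balaban1983to89
open Literature.MathematicalPhysics.QuantumFieldTheory.Balaban1983to89.Beta
open B6Lemma24Torus (pbox)
open ExpKernelCalculus (MKer)
open AffineAveraging (Site)
open OneStepResolventKernel (Fib)
open WilsonBiStencil (wilsonW₂)
open WilsonVertex2Sym (swapIJ symTab swapIJ_symTab wsym22 wsym22_swap_left wilsonW₂_transpose)
open Summit.QuantumFields.BalabanUV.Beta.FP.KernelPeriodisationFib (Idx perF perF_apply trF perF_transpose)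
open Summit.QuantumFields.BalabanUV.Beta.FP.KernelPeriodisationFibLoc (dper dper_apply dper_translate)

variable {d : ℕ} (M : Fin (d + 1) → ℕ) (T : Fin 4 → Fin 4 → Fin 4 → Fin 4 → ℝ)

/-! ## §1 Kernel level: the lattice-summed bi-stencil of a leg-symmetric table is transpose-invariant -/

/-- [folklore] `trF (dper M (wilsonW₂ d T κ u κ′ u′)) = dper M (wilsonW₂ d T κ u κ′ u′)` when `swapIJ T = T`. -/
theorem trF_dper_wilsonW₂ (hT : swapIJ T = T) (κ : Fin (d + 1)) (u : Site (d + 1)) (κ' : Fin (d + 1)) (u' : Site (d + 1)) :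
    trF (dper M (wilsonW₂ d T κ u κ' u')) = dper M (wilsonW₂ d T κ u κ' u') := by
  funext x y a b
  simp only [trF, dper_apply]
  exact tsum_congr fun m => by rw [wilsonW₂_transpose, hT]

/-- [folklore] hence its periodisation is a symmetric matrix. -/
theorem perF_dper_wilsonW₂_transpose (hT : swapIJ T = T) (κ : Fin (d + 1)) (u : Site (d + 1)) (κ' : Fin (d + 1)) (u' : Site (d + 1)) :
    (perF M (dper M (wilsonW₂ d T κ u κ' u')))ᵀ = perF M (dper M (wilsonW₂ d T κ u κ' u')) := by
  rw [← perF_transpose M (fun m x y a b => dper_translate M (wilsonW₂ d T κ u κ' u') m x y a b), trF_dper_wilsonW₂ M T hT]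

/-! ## §2 The torus call's field index: each member and every bi-weighted sum is symmetric -/

/-- [folklore] **EACH MEMBER OF THE SECOND-ORDER FORM-INSERTION FAMILY IS SYMMETRIC**: `(H₂^{b b′})ᵀ = H₂^{b b′}`,
`H₂^{b b′} := perF M (dper M (wilsonW₂ d T b.2 b.1 b′.2 b′.1))∘(fields, fields)`, for `swapIJ T = T`. -/
theorem torus_H2_family_transpose (hT : swapIJ T = T) (b b' : ↥(pbox M) × Fin (d + 1)) :
    ((perF M (dper M (wilsonW₂ d T b.2 (b.1 : Site (d + 1)) b'.2 (b'.1 : Site (d + 1))))).submatrix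
        (fun c : ↥(pbox M) × Fin (d + 1) => ((c.1, Sum.inl c.2) : Idx M (Fib d)))
        (fun c : ↥(pbox M) × Fin (d + 1) => ((c.1, Sum.inl c.2) : Idx M (Fib d))))ᵀ
      = (perF M (dper M (wilsonW₂ d T b.2 (b.1 : Site (d + 1)) b'.2 (b'.1 : Site (d + 1))))).submatrix
        (fun c : ↥(pbox M) × Fin (d + 1) => ((c.1, Sum.inl c.2) : Idx M (Fib d)))
        (fun c : ↥(pbox M) × Fin (d + 1) => ((c.1, Sum.inl c.2) : Idx M (Fib d))) := by
  rw [Matrix.transpose_submatrix, perF_dper_wilsonW₂_transpose M T hT]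

/-- [folklore] **THE SECOND-ORDER FORM JET ALONG ANY BI-WEIGHT IS SYMMETRIC**: `(Σ_{b b′} w b b′ • H₂^{b b′})ᵀ = Σ_{b b′} w b b′ • H₂^{b b′}`
(e.g. `w b b′ := h b · h b′` for the second jet along an inserted one-form `h`), for `swapIJ T = T`. -/
theorem torus_H2_transpose (hT : swapIJ T = T) (w : ↥(pbox M) × Fin (d + 1) → ↥(pbox M) × Fin (d + 1) → ℝ) :
    (∑ b : ↥(pbox M) × Fin (d + 1), ∑ b' : ↥(pbox M) × Fin (d + 1), w b b' •
        (perF M (dper M (wilsonW₂ d T b.2 (b.1 : Site (d + 1)) b'.2 (b'.1 : Site (d + 1))))).submatrix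
          (fun c : ↥(pbox M) × Fin (d + 1) => ((c.1, Sum.inl c.2) : Idx M (Fib d)))
          (fun c : ↥(pbox M) × Fin (d + 1) => ((c.1, Sum.inl c.2) : Idx M (Fib d))))ᵀ
      = ∑ b : ↥(pbox M) × Fin (d + 1), ∑ b' : ↥(pbox M) × Fin (d + 1), w b b' •
        (perF M (dper M (wilsonW₂ d T b.2 (b.1 : Site (d + 1)) b'.2 (b'.1 : Site (d + 1))))).submatrix
          (fun c : ↥(pbox M) × Fin (d + 1) => ((c.1, Sum.inl c.2) : Idx M (Fib d)))
          (fun c : ↥(pbox M) × Fin (d + 1) => ((c.1, Sum.inl c.2) : Idx M (Fib d))) := by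
  rw [Matrix.transpose_sum]
  refine Finset.sum_congr rfl fun b _ => ?_
  rw [Matrix.transpose_sum]
  exact Finset.sum_congr rfl fun b' _ => by rw [Matrix.transpose_smul, torus_H2_family_transpose M T hT]

/-! ## §3 Instances of the leg-symmetry hypothesis -/

/-- [folklore] the symmetrised trace table is leg-symmetric: `swapIJ (wsym22 N) = wsym22 N` (`WilsonVertex2Sym.wsym22_swap_left`). -/
theorem swapIJ_wsym22 (N : ℕ) : swapIJ (wsym22 N) = wsym22 N := by
  funext i j k l
  exact wsym22_swap_left N i j k l

omit M in
/-- [folklore] leg-symmetry is preserved by scalar multiples. -/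
theorem swapIJ_smul_of_swapIJ (r : ℝ) (hT : swapIJ T = T) : swapIJ (r • T) = r • T := by
  funext i j k l
  have h := congrFun (congrFun (congrFun (congrFun hT i) j) k) l
  simp only [swapIJ, Pi.smul_apply, smul_eq_mul] at h ⊢
  rw [h]

/-- [folklore] `torus_H2_transpose` for a symmetrised table `symTab T′` (`WilsonVertex2Sym.swapIJ_symTab`). -/
theorem torus_H2_transpose_symTab (T' : Fin 4 → Fin 4 → Fin 4 → Fin 4 → ℝ)
    (w : ↥(pbox M) × Fin (d + 1) → ↥(pbox M) × Fin (d + 1) → ℝ) :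
    (∑ b : ↥(pbox M) × Fin (d + 1), ∑ b' : ↥(pbox M) × Fin (d + 1), w b b' •
        (perF M (dper M (wilsonW₂ d (symTab T') b.2 (b.1 : Site (d + 1)) b'.2 (b'.1 : Site (d + 1))))).submatrix
          (fun c : ↥(pbox M) × Fin (d + 1) => ((c.1, Sum.inl c.2) : Idx M (Fib d)))
          (fun c : ↥(pbox M) × Fin (d + 1) => ((c.1, Sum.inl c.2) : Idx M (Fib d))))ᵀ
      = ∑ b : ↥(pbox M) × Fin (d + 1), ∑ b' : ↥(pbox M) × Fin (d + 1), w b b' •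
        (perF M (dper M (wilsonW₂ d (symTab T') b.2 (b.1 : Site (d + 1)) b'.2 (b'.1 : Site (d + 1))))).submatrix
          (fun c : ↥(pbox M) × Fin (d + 1) => ((c.1, Sum.inl c.2) : Idx M (Fib d)))
          (fun c : ↥(pbox M) × Fin (d + 1) => ((c.1, Sum.inl c.2) : Idx M (Fib d))) :=
  torus_H2_transpose M (symTab T') (swapIJ_symTab T') w

/-- [folklore] `torus_H2_transpose` for ANY scalar multiple of the symmetrised trace table, `T := r • wsym22 N` (e.g. the wall's
`(8N²)⁻¹ • wsym22 N`). -/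
theorem torus_H2_transpose_wsym22 (N : ℕ) (r : ℝ) (w : ↥(pbox M) × Fin (d + 1) → ↥(pbox M) × Fin (d + 1) → ℝ) :
    (∑ b : ↥(pbox M) × Fin (d + 1), ∑ b' : ↥(pbox M) × Fin (d + 1), w b b' •
        (perF M (dper M (wilsonW₂ d (r • wsym22 N) b.2 (b.1 : Site (d + 1)) b'.2 (b'.1 : Site (d + 1))))).submatrix
          (fun c : ↥(pbox M) × Fin (d + 1) => ((c.1, Sum.inl c.2) : Idx M (Fib d)))
          (fun c : ↥(pbox M) × Fin (d + 1) => ((c.1, Sum.inl c.2) : Idx M (Fib d))))ᵀ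
      = ∑ b : ↥(pbox M) × Fin (d + 1), ∑ b' : ↥(pbox M) × Fin (d + 1), w b b' •
        (perF M (dper M (wilsonW₂ d (r • wsym22 N) b.2 (b.1 : Site (d + 1)) b'.2 (b'.1 : Site (d + 1))))).submatrix
          (fun c : ↥(pbox M) × Fin (d + 1) => ((c.1, Sum.inl c.2) : Idx M (Fib d)))
          (fun c : ↥(pbox M) × Fin (d + 1) => ((c.1, Sum.inl c.2) : Idx M (Fib d))) :=
  torus_H2_transpose M (r • wsym22 N) (swapIJ_smul_of_swapIJ (wsym22 N) r (swapIJ_wsym22 N)) w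

end Summit.QuantumFields.BalabanUV.Beta.FP.PeriodisedFormOrderTwoParity

end
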